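import Mathlib.Topology.Order.Compact
import Mathlib.Order.Closure
import Mathlib.Analysis.Normed.Field.Basic
import HarnessLib

/-!
# Joshi, *Arithmetic Teichmüller Spaces III* (arXiv:2401.13508v4) §9.8.1: the DEFINITION of the theta-values loci
# `Θ̃^𝓘_Mochizuki`, `Θ̃^𝓘_Joshi` (Theorem-Definition 9.8.1.1) and Corollary 9.8.1.3 — TYPED over a collation signature

Record file of the abc-iut cell, branch E «type Joshi's construction, test vs S» (rung LADDER-ABC:A2.E; seat abc-iut-E-t22,
slot T-22, OBJECTS.tsv O-043; plan/E/E-PLAN.md, plan/E/t22/INVENTORY.tsv). Source: K. Joshi, arXiv:2401.13508 **v4**,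
«Preliminary version for comments» — UNREFEREED (bib `Joshi2024ATS3`; rejected by the IUT author, `Mochizuki2024JoshiReport`);
render `HOME/lit/renders/Joshi-arxiv-2401.13508/pNNNN.txt`, «p.N l.M» = line M of page N. **No side is taken** on [IUTchIII]
Cor. 3.12, on Joshi's claims or on Mochizuki's report: every statement print ASSERTS is a `Prop`-valued READING PREDICATE with
its locator (`@[claim "Joshi2024ATS3" "disputed"]`, the registered word recording that a dispute exists in print), never an
axiom, instance, `sorry` or Literature fact; PROVED below is only what follows from the typed signature. TYPED ≠ PROVED ≠ ENDORSED.

WHAT §9.8 DEFINES. Thm-Def 9.8.1.1 (p.113 l.67 – p.116 l.52; «essentially [Mochizuki, 2021c, Theorem 3.11]», p.113 l.54–55):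
for each `z = (y_1, …, y_{ℓ*})` in Mochizuki's Adelic Ansatz `Σ̃_{L′}` ((4.1.2); extended tuple `(z_0, …, z_{ℓ*})`, §9.4.4
p.102 l.14–27): (1)(d) the classes `ξ^{Joshi}_z = (ξ_{y_1}, …, ξ_{y_{ℓ*}}) ∈ ∏_j H¹_e(arith(L_mod)_{y_j}, ℤ(1))` ((9.7.4.2) p.112
l.1–34); (1)(e) `ξ^{Mochizuki}_z = ((1+p*) ∈ S_1, (1+p*, ξ_{y_1}) ∈ S_2, …, (1+p*, …, 1+p*, ξ_{y_{ℓ*}}) ∈ S_{ℓ*+1})`, `1+p*` the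
compatible `p^n`-th roots of `1+p*_w` (p.113 l.55–66), `S_{j+1} = {0, …, j}` (§9.4.5); (1)(f) their Bloch–Kato logarithms in
the product codomains `Ĩ_Mochizuki` (§9.4.7) / `Ĩ_Joshi` (§9.4.9; Prop. 9.4.9.3 p.106: `≅ H¹_e(arith(L′)_{y_{ℓ*}}, ℤ(1))^{ℓ*}`);
(2)/(3) `G_{L′}` and `φ` act THROUGH `Σ̃_{L′}` (p.115 l.7–40); (4) `Θ̃^{Ĩ}_Joshi := Convex Closure of Ψ^{Joshi}_{Σ̃_{L′}} ⊂ Ĩ_Joshi`,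
(5) `Θ̃^{Ĩ}_Mochizuki := Convex Closure of Ψ^{Mochizuki}_{Σ̃_{L′}} ⊂ Ĩ_Mochizuki`, `Ψ` = the COLLATION of Prop. 9.7.5.1 (p.112
l.40–71: images «under all (topological) isomorphisms `H¹_e(arith(L′)_y, ℤ(1)) ≃ H¹_e(arith(L′)_{y_0}, ℤ(1))` given by [Joshi,
2023a, Prop. 7.4.1]»; arXiv:2305.10398 Prop. 7.5.1 p.49 l.7–11 «of each factor») into the STANDARD arithmeticoid `y_0` (§4.4);
(6) `Θ̃^{𝓘} :=` images under `Ĩ^ℚ → 𝓘^ℚ` (tensor codomains); (7) `Θ̃^{Ĩ} ⊂ Ĩ ⊂ Ĩ^ℚ`, `Θ̃^{𝓘} ⊂ 𝓘 ⊂ 𝓘^ℚ` «are Mochizuki's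
multi-radial representations of Theta-values i.e. the Theta-values locii of [Mochizuki, 2021c, Theorem 3.11, Corollary 3.12]»
(p.116 l.43–50); Rmk. 9.8.1.2; Cor. 9.8.1.3 (p.116 l.63 – p.117 l.6: the loci lie in compact subsets). The SIZES of §9.8.2
((9.8.2.1)–(9.8.2.5), Rmk. 9.8.2.3, Cor. 9.8.2.6, Lemma 9.8.2.7) are the sequel `Joshi/ThetaLociSizes.lean` over the same signature.

TYPING (INTERIM CARRIER RULE, plan/E/ASSIGNMENTS.md §0.3: self-contained signature, merge-debts named). `TensorPacketLociDatum` carries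
exactly what (1)(d)–(f), (4)–(7), §9.8.2 READ: `Σ̃_{L′}` as an index type with extended tuples (merge-debt T-07/T-08);
per-arithmeticoid class carriers `H y w` = «`H¹_e(arith(L′)_y, ℤ(1))` at `w`» IDENTIFIED with their `log_BK`-images in the
log-shell (Prop. 9.7.2.3 p.111; merge-debt T-21), with `ξ_{y,w}`, `1+p*_w` and the intrinsic `|−|_{K_{y_w}}` (valuation scaling
Thm. 4.2.2.1 (4) lives in these; T-07/E-t4); ONE standard coordinate space `V w ⊃ shell w` per place (`I^{ℚ_p}(L′_w) ⊃ I(L′_w)`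
at `y_0`, (9.4.1.1)–(9.4.1.3), Def. 9.4.11.1; merge-debt T-19/T-20); collation maps `coll y w` (a SET of maps `H y w → V w` into
the shell; print: ALL topological-group isomorphisms — merge-debt T-21, dictionary row D-10); abstract convex closures (§5.3.3
p.41 l.35–39; T-09/T-23); abstract tensor codomains `TJ`, `TM` with continuous comparison maps and tensor norms (§9.4.6–9.4.9,
§7.6; T-20/T-14). (1)(a)–(c) (prime-strips, tempered Frobenioids, Hodge theaters) are not read by (4)–(7): left to T-17/T-34.
The hypotheses «§2.4, §3.1, §3.3» are T-06's / E-t4's structures, not restated. E-t4's `ATS3.LocusDatum` (p428048; the REAL NUMBERS §9.9–9.11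
read per place) is reached by the projection `toLocusDatum` of the sequel — recorded, not asserted.

FLAGS for the faithfulness referee (no adjudication): (i) index slips in (1)(e) as printed (`∏_{i=0}^{j+1}`; «∈ S_j» vs
`S_{j+1}`) — typed: label `j` carries a `(j+1)`-tuple over `S_{j+1}` with `1+p*` at `a < j`, `ξ_{y_j}` at `a = j`; (ii) (4)
feeds Prop. 9.7.5.1 TUPLES of classes of ℓ* DIFFERENT arithmeticoids — typed as componentwise, factorwise collation; (iii)
«all (topological) isomorphisms» is typed as an abstract SET of maps per `(y, w)` (whether it is literally every
topological-group isomorphism — wider than isometries — is the dictionary question D-10, not settled here); (iv) base fields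
`arith(L_mod)`/`arith(L)`/`arith(L′)` vary in print — one index set `W ≃ 𝕍 ≃ 𝕍_{L_mod}` (§3.1/§3.3) is used.

OUR-side counterparts (E3 hints only; the typed dictionary Props D-09–D-12 live in `Joshi/Dictionary.lean` per E-PLAN R4b;
nothing of OUR side is imported or restated): `Ψ`/«all isomorphisms» ↔ `Cor312.Setting.possibleImages` (translates by
`Subgroup.closure (Ind1Family ∪ Ind2Family)`); convex closure ↔ `Cor312.HullFrame.hullClosure` (Prop. 9.10.8.1);
`Θ̃^{𝓘}_Mochizuki` at `(j, ·)` ↔ `Cor312.Setting.thetaHull j vQ`; `S_{j+1}` ↔ `Thm311.ThetaIndex.Caps j`; standard point `z_Θ`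
(`y_{ℓ*} = y′_0`, §4.5) ↔ the q-pilot Kummer datum `qK` (D-06); `|Θ̃|` ↔ `Cor312.Setting.negLogTheta` (D-05). Deliberately NOT
here: §9.9–9.11 (T-23, E-t4), §9.4's construction (T-20), Prop. 9.7.5.1 itself (T-21), any judgement.
[claim: Joshi2024ATS3, status: disputed]
-/

noncomputable section

open Set

namespace Summit.ABC.IUTFork.Joshi.ATS3

/-! ## 1. The collation signature: what Thm-Def 9.8.1.1 (1)(d)–(f), (4)–(7) and §9.8.2 read -/

/-- **Tensor-packet loci datum** (collation signature) — the signature over which [J-III] §9.8 defines the theta-values loci (locators field by field;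
module docstring for the modelling). Parameters: places `W` (`≃ 𝕍 ≃ 𝕍_{L_mod}`, §3.1/§3.3), the standard coordinate spaces
`V w` (`I^{ℚ_p}(L′_w)` at the standard arithmeticoid, (9.4.1.3)/(9.4.2.2) p.100–101), the tensor codomains `TJ = 𝓘^ℚ_Joshi`,
`TM = 𝓘^ℚ_Mochizuki` ((9.4.8.1), (9.4.6.8)). SIGNATURE: data and the structural facts print invokes (compact factors, existing
collation isomorphisms landing in the standard `H¹_e(−, ℤ(1))`, continuity); none of print's §9.8 assertions is a field.
[claim: Joshi2024ATS3, status: disputed] -/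
structure TensorPacketLociDatum (W : Type) (V : W → Type) [∀ w, TopologicalSpace (V w)] (TJ TM : Type)
    [TopologicalSpace TJ] [TopologicalSpace TM] : Type 1 where
  /-- `ℓ* = (ℓ − 1)/2` -/
  lstar : ℕ
  /-- `𝕍^{odd,ss} ⊂ 𝕍`, the finite set of odd semi-stable places (§3.3; Thm. 7.3.1 proof p.55 l.13–16) -/
  Wss : Finset W
  /-- arithmeticoids / points `y ∈ 𝒴′_{L′}` (§4.1, arXiv:2305.10398 §5) -/
  Y : Type
  /-- the standard arithmeticoid `y′_0` (§4.4) -/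
  y₀ : Y
  /-- Mochizuki's Adelic Ansatz `Σ̃_{L′} ⊂ (𝒴′_{L′})^{ℓ*}` ((4.1.2), Def. 4.2.2), as an index type -/
  Z : Type
  /-- the extended tuple `(z_0, z_1, …, z_{ℓ*})` of `z ∈ Σ̃_{L′}` (§9.4.4): label `j ↦ z_j` -/
  ext : Z → Fin (lstar + 1) → Y
  /-- the standard point `z_Θ ∈ Σ̃_{L′}` (§4.5) -/
  zTheta : Z
  /-- `y_{ℓ*} = y′_0` at the standard point (§4.5 p.36 l.13–17) -/
  zTheta_last : ext zTheta (Fin.last lstar) = y₀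
  /-- the self-maps `z ↦ σ(z)`, `z ↦ φ(z)` of `Σ̃_{L′}` (Def. 4.2.1 (1)(2); Thm-Def 9.8.1.1 (2)(3)) -/
  sym : Set (Z → Z)
  /-- `H¹_e(arith(L′)_y, ℤ(1))` at the place `w`, in log-coordinates (Prop. 9.7.2.3) -/
  H : Y → W → Type
  /-- `log_BK(ξ_{y,w})`, the class (9.7.4.2) of the holomorphoid `hol(X/L′)_y` at `w` -/
  xi : ∀ y w, H y w
  /-- `log_BK((1+p*_w)^{1/p^n})`, the unit class (p.113 l.55–66; (9.7.4.2) at `w ∉ 𝕍^{odd,ss}`) -/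
  one : ∀ y w, H y w
  /-- `|−|_{K_{y_w}}`, the absolute value of the residue field of `y_w` read on classes ((9.8.2.1)) -/
  nrm : ∀ y w, H y w → ℝ
  /-- the log-shell `I(L′_w) ⊂ I^{ℚ_p}(L′_w)` of the standard arithmeticoid ((9.4.1.1), Def. 9.4.11.1) -/
  shell : ∀ w, Set (V w)
  /-- «each of factors of the Galois cohomology of an arithmeticoid `H¹_e(arith(L′), ℤ(1))` is compact» (p.117 l.1–3) -/
  shell_compact : ∀ w, IsCompact (shell w)
  /-- the collation maps at `(y, w)`: «all (topological) isomorphisms … given by [Joshi, 2023a, Prop. 7.4.1]» (p.112 l.65–70) -/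
  coll : ∀ y w, Set (H y w → V w)
  /-- amphoricity (arXiv:2305.10398 Prop. 7.4.1 (3)): such isomorphisms exist -/
  coll_nonempty : ∀ y w, (coll y w).Nonempty
  /-- the collation maps land in `H¹_e(arith(L′)_{y_0}, ℤ(1))` = the standard log-shell -/
  coll_mem : ∀ y w (ι : H y w → V w), ι ∈ coll y w → ∀ h, ι h ∈ shell w
  /-- the convex closure on `Ĩ^ℚ_Joshi` (§5.3.3 p.41 l.35–39: «the smallest, closed, convex subset containing S») -/
  convJ : ClosureOperator (Set (Fin lstar → ∀ w, V w))
  /-- the convex closure on `Ĩ^ℚ_Mochizuki` -/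
  convM : ClosureOperator (Set (∀ j : Fin lstar, Fin ((j : ℕ) + 2) → ∀ w, V w))
  /-- `Ĩ^ℚ_Joshi → 𝓘^ℚ_Joshi` (§9.4.9, «natural homomorphism given by the tensor product construction») -/
  toTensorJ : (Fin lstar → ∀ w, V w) → TJ
  /-- … is continuous (Cor. 9.8.1.3 proof p.116 l.73–74 «(continuous) homomorphisms») -/
  toTensorJ_continuous : Continuous toTensorJ
  /-- `Ĩ^ℚ_Mochizuki → 𝓘^ℚ_Mochizuki` (§9.4.7 p.105 l.11–20) -/
  toTensorM : (∀ j : Fin lstar, Fin ((j : ℕ) + 2) → ∀ w, V w) → TM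
  /-- … is continuous -/
  toTensorM_continuous : Continuous toTensorM
  /-- the homomorphism `𝓘_Mochizuki → 𝓘_Joshi` (§9.8 rmk (1) p.113 l.2) -/
  tensorMJ : TM → TJ
  /-- the tensor-product norm on `𝓘^ℚ_Joshi` (§7.6; p.117 l.109–126) -/
  tnrmJ : TJ → ℝ
  /-- … is continuous -/
  tnrmJ_continuous : Continuous tnrmJ
  /-- the tensor-product norm on `𝓘^ℚ_Mochizuki` -/
  tnrmM : TM → ℝ
  /-- … is continuous -/
  tnrmM_continuous : Continuous tnrmM

namespace TensorPacketLociDatum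

variable {W : Type} {V : W → Type} [∀ w, TopologicalSpace (V w)] {TJ TM : Type} [TopologicalSpace TJ]
  [TopologicalSpace TM] (C : TensorPacketLociDatum W V TJ TM)

/-! ## 2. Codomains, extended tuples, the two tuples of classes (Thm-Def 9.8.1.1 (1)(d)–(f)) -/

/-- `Ĩ^ℚ_Joshi = ∏_{j=1}^{ℓ*} I^ℚ_{p,y_j} ≅ H¹_e(arith(L′)_{y_{ℓ*}}, ℚ(1))^{ℓ*}` in standard coordinates ((9.4.9.1), (9.4.9.5)
p.105 l.46 – p.106 l.44); label `j = i + 1`. [claim: Joshi2024ATS3, status: disputed] -/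
abbrev ProdJ : Type := Fin C.lstar → ∀ w, V w

/-- `Ĩ^ℚ_Mochizuki = ∏_{j=1}^{ℓ*} S̃_{j+1} I^ℚ_p`, `S_{j+1} = {0, 1, …, j}` ((9.4.7.1) p.105 l.1–10; §9.4.5 p.102 l.28 –
p.103 l.12), in standard coordinates; label `j = i + 1`, so `S_{j+1} = Fin (i + 2)`. [claim: Joshi2024ATS3, status: disputed] -/
abbrev ProdM : Type := ∀ i : Fin C.lstar, Fin ((i : ℕ) + 2) → ∀ w, V w

/-- `Ĩ_Joshi ⊂ Ĩ^ℚ_Joshi`: the product of the log-shells ((9.4.9.1)). [claim: Joshi2024ATS3, status: disputed] -/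
def shellsJ : Set C.ProdJ := Set.pi univ fun _ => Set.pi univ fun w => C.shell w

/-- `Ĩ_Mochizuki ⊂ Ĩ^ℚ_Mochizuki`: the product of the log-shells ((9.4.7.1)). [claim: Joshi2024ATS3, status: disputed] -/
def shellsM : Set C.ProdM := Set.pi univ fun _ => Set.pi univ fun _ => Set.pi univ fun w => C.shell w

/-- The projection `Ĩ^ℚ_Mochizuki ↠ Ĩ^ℚ_Joshi` «onto the `(j+1)`th factor of each `S_{j+1}`» (p.106 l.12–19).
[claim: Joshi2024ATS3, status: disputed] -/
def projMJ (x : C.ProdM) : C.ProdJ := fun i w => x i (Fin.last _) w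

/-- `y_j`, the `j`-th arithmeticoid of `z = (y_1, …, y_{ℓ*}) ∈ Σ̃_{L′}` (`j = i + 1`). [claim: Joshi2024ATS3, status: disputed] -/
def pt (z : C.Z) (i : Fin C.lstar) : C.Y := C.ext z i.succ

/-- `z_a`, `a ∈ S_{j+1} = {0, …, j}`, the members of the extended tuple entering the label-`j` component of
`ξ^{Mochizuki}_z` (Thm-Def 9.8.1.1 (1)(e); §9.4.4). [claim: Joshi2024ATS3, status: disputed] -/
def extAt (z : C.Z) (i : Fin C.lstar) (a : Fin ((i : ℕ) + 2)) : C.Y :=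
  C.ext z (Fin.castLE (by have := i.is_lt; omega) a)

/-- **`ξ^{Mochizuki}_z`** (Thm-Def 9.8.1.1 (1)(e), p.114 l.39–59, AS READ: the label-`j` component is the `(j+1)`-tuple
`(1+p*, …, 1+p*, ξ_{y_j})` over `S_{j+1} = {0, …, j}` — unit classes of `z_0, …, z_{j−1}` at `a < j`, the class `ξ_{y_j}` at
`a = j`), at the place `w`. Rmk. 9.8.1.2 (p.116 l.53–62): «Despite the notation `ξ^{Mochizuki}_z` these crystalline Galois
cohomology classes are not used by Mochizuki in [Mochizuki, 2021a,b,c]. His method uses a multiplicative action of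
theta-values on log-shells … However, one can obviously follow Mochizuki's approach to constructing the theta-values locus
`Θ̃^𝓘_Mochizuki`.» [claim: Joshi2024ATS3, status: disputed] -/
def xiM (z : C.Z) (i : Fin C.lstar) (a : Fin ((i : ℕ) + 2)) (w : W) : C.H (C.extAt z i a) w :=
  if (a : ℕ) = (i : ℕ) + 1 then C.xi (C.extAt z i a) w else C.one (C.extAt z i a) w

/-- The last member `a = j` of the label-`j` block of the extended tuple is `y_j` itself. [folklore] -/
theorem extAt_last (z : C.Z) (i : Fin C.lstar) : C.extAt z i (Fin.last _) = C.pt z i := rfl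

/-- The projection `Ĩ_M ↠ Ĩ_J` carries the product of shells onto the product of shells. [folklore] -/
theorem projMJ_mem_shellsJ {x : C.ProdM} (hx : x ∈ C.shellsM) : C.projMJ x ∈ C.shellsJ := by
  simp only [shellsM, shellsJ, mem_univ_pi] at hx ⊢
  exact fun i w => hx i _ w

/-! ## 3. Collation (Prop. 9.7.5.1) and the loci (Thm-Def 9.8.1.1 (4)–(7)) -/

/-- **`Ψ^{Joshi}_{Σ̃_{L′}} ⊂ Ĩ^ℚ_Joshi`** (Thm-Def 9.8.1.1 (4) with Prop. 9.7.5.1, p.115 l.41–54 / p.112 l.52–70): the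
tuples whose `(j, w)`-component is the image of `log_BK(ξ_{y_j,w})` under SOME collation map at `(y_j, w)`, over all
`z = (y_1, …, y_{ℓ*}) ∈ Σ̃_{L′}` (componentwise, factorwise — FLAG (ii) of the module docstring). [claim: Joshi2024ATS3, status: disputed] -/
def psiJ : Set C.ProdJ :=
  {x | ∃ z : C.Z, ∀ (i : Fin C.lstar) (w : W), ∃ ι ∈ C.coll (C.pt z i) w, x i w = ι (C.xi (C.pt z i) w)}

/-- **`Ψ^{Mochizuki}_{Σ̃_{L′}} ⊂ Ĩ^ℚ_Mochizuki`** (Thm-Def 9.8.1.1 (5), p.115 l.55 – p.116 l.9): the same with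
`log_BK(ξ^{Mochizuki}_z)` and `A = ∏_j S_j`. [claim: Joshi2024ATS3, status: disputed] -/
def psiM : Set C.ProdM :=
  {x | ∃ z : C.Z, ∀ (i : Fin C.lstar) (a : Fin ((i : ℕ) + 2)) (w : W),
    ∃ ι ∈ C.coll (C.extAt z i a) w, x i a w = ι (C.xiM z i a w)}

/-- **`Θ̃^{Ĩ}_Joshi := Convex Closure of Ψ^{Joshi}_{Σ̃_{L′}}`** (Thm-Def 9.8.1.1 (4), p.115 l.47–54).
[claim: Joshi2024ATS3, status: disputed] -/
def thetaLocusProdJ : Set C.ProdJ := C.convJ C.psiJ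

/-- **`Θ̃^{Ĩ}_Mochizuki := Convex Closure of Ψ^{Mochizuki}_{Σ̃_{L′}}`** (Thm-Def 9.8.1.1 (5), p.116 l.1–9).
[claim: Joshi2024ATS3, status: disputed] -/
def thetaLocusProdM : Set C.ProdM := C.convM C.psiM

/-- **`Θ̃^{𝓘}_Joshi`** := the image of `Θ̃^{Ĩ}_Joshi` under `Ĩ^ℚ_Joshi → 𝓘^ℚ_Joshi` (Thm-Def 9.8.1.1 (6), p.116 l.10–17).
[claim: Joshi2024ATS3, status: disputed] -/
def thetaLocusTensorJ : Set TJ := C.toTensorJ '' C.thetaLocusProdJ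

/-- **`Θ̃^{𝓘}_Mochizuki`** := the image of `Θ̃^{Ĩ}_Mochizuki` under `Ĩ^ℚ_Mochizuki → 𝓘^ℚ_Mochizuki` (Thm-Def 9.8.1.1 (6),
p.116 l.17–24). [claim: Joshi2024ATS3, status: disputed] -/
def thetaLocusTensorM : Set TM := C.toTensorM '' C.thetaLocusProdM

/-- `Ψ^{Joshi} ⊆ Θ̃^{Ĩ}_Joshi` (a closure contains its argument). [folklore] -/
theorem psiJ_subset_thetaLocusProdJ : C.psiJ ⊆ C.thetaLocusProdJ := C.convJ.le_closure _

/-- `Ψ^{Mochizuki} ⊆ Θ̃^{Ĩ}_Mochizuki`. [folklore] -/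
theorem psiM_subset_thetaLocusProdM : C.psiM ⊆ C.thetaLocusProdM := C.convM.le_closure _

/-- `Ψ^{Joshi} ⊆ Ĩ_Joshi`: collation maps land in the standard log-shells. [folklore] -/
theorem psiJ_subset_shellsJ : C.psiJ ⊆ C.shellsJ := by
  rintro x ⟨z, hz⟩
  simp only [shellsJ, mem_univ_pi]
  intro i w
  obtain ⟨ι, hι, hx⟩ := hz i w
  rw [hx]
  exact C.coll_mem _ _ ι hι _

/-- `Ψ^{Mochizuki} ⊆ Ĩ_Mochizuki`. [folklore] -/
theorem psiM_subset_shellsM : C.psiM ⊆ C.shellsM := by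
  rintro x ⟨z, hz⟩
  simp only [shellsM, mem_univ_pi]
  intro i a w
  obtain ⟨ι, hι, hx⟩ := hz i a w
  rw [hx]
  exact C.coll_mem _ _ ι hι _

/-- Thm-Def 9.8.1.1 (2)(3) (p.115 l.7–40): `G_{L′}` and `φ` act THROUGH `Σ̃_{L′}` («the groups on the right do not carry
any action»): the collated classes of `σ(z)`, `φ(z)` — of ANY `s z` — lie in `Ψ^{Joshi}` again, so the locus (4), a closure
of a union over all of `Σ̃_{L′}`, is insensitive to these re-indexings. [folklore] -/
theorem mem_psiJ_reindex (s : C.Z → C.Z) (z : C.Z) (x : C.ProdJ)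
    (hx : ∀ (i : Fin C.lstar) (w : W), ∃ ι ∈ C.coll (C.pt (s z) i) w, x i w = ι (C.xi (C.pt (s z) i) w)) :
    x ∈ C.thetaLocusProdJ :=
  C.psiJ_subset_thetaLocusProdJ ⟨s z, hx⟩

/-- **(7), first chain: `Θ̃^{Ĩ}_Joshi ⊂ Ĩ_Joshi`** (p.116 l.25–29). READING PREDICATE (derived below from convex-stability of
the shells). [claim: Joshi2024ATS3, status: disputed] -/
@[claim "Joshi2024ATS3" "disputed"]
def LocusInShellsJ : Prop := C.thetaLocusProdJ ⊆ C.shellsJ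

/-- **(7), third chain: `Θ̃^{Ĩ}_Mochizuki ⊂ Ĩ_Mochizuki`** (p.116 l.34–38). READING PREDICATE. [claim: Joshi2024ATS3, status: disputed] -/
@[claim "Joshi2024ATS3" "disputed"]
def LocusInShellsM : Prop := C.thetaLocusProdM ⊆ C.shellsM

/-- What the printed proof of (7) («easily assembled from already established facts», p.116 l.51–52) uses: the product of
log-shells is stable under the convex closure (log-shells are compact `ℤ_p`-submodules, §9.2 / Prop. 9.7.2.3; convexity à la
[Schneider 2002, Ch. I], §5.3.3). READING PREDICATE on the signature. [claim: Joshi2024ATS3, status: disputed] -/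
@[claim "Joshi2024ATS3" "disputed"]
def ShellsConvexStableJ : Prop := C.convJ C.shellsJ ⊆ C.shellsJ

/-- The same for `Ĩ_Mochizuki`. [claim: Joshi2024ATS3, status: disputed] -/
@[claim "Joshi2024ATS3" "disputed"]
def ShellsConvexStableM : Prop := C.convM C.shellsM ⊆ C.shellsM

/-- (7) for `Θ̃^{Ĩ}_Joshi` DERIVED: `Ψ ⊆ Ĩ` and `Ĩ` convex-stable ⟹ `Conv(Ψ) ⊆ Ĩ`. [folklore] -/
theorem locusInShellsJ_of (h : C.ShellsConvexStableJ) : C.LocusInShellsJ :=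
  (C.convJ.monotone C.psiJ_subset_shellsJ).trans h

/-- (7) for `Θ̃^{Ĩ}_Mochizuki` DERIVED. [folklore] -/
theorem locusInShellsM_of (h : C.ShellsConvexStableM) : C.LocusInShellsM :=
  (C.convM.monotone C.psiM_subset_shellsM).trans h

/-- (7), second/fourth chains: the tensor loci lie in `𝓘 = im(Ĩ)` (images of the shells). [folklore] -/
theorem thetaLocusTensor_subset_image (hJ : C.LocusInShellsJ) (hM : C.LocusInShellsM) :
    C.thetaLocusTensorJ ⊆ C.toTensorJ '' C.shellsJ ∧ C.thetaLocusTensorM ⊆ C.toTensorM '' C.shellsM :=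
  ⟨image_mono hJ, image_mono hM⟩

/-! ## 4. Corollary 9.8.1.3: the loci lie in compact subsets -/

/-- `Ĩ_Joshi` is compact («each of factors … is compact and the topology … is the product topology», p.117 l.1–6;
Tychonoff). [folklore] -/
theorem isCompact_shellsJ : IsCompact C.shellsJ :=
  isCompact_univ_pi fun _ => isCompact_univ_pi fun w => C.shell_compact w

/-- `Ĩ_Mochizuki` is compact. [folklore] -/
theorem isCompact_shellsM : IsCompact C.shellsM :=
  isCompact_univ_pi fun _ => isCompact_univ_pi fun _ => isCompact_univ_pi fun w => C.shell_compact w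

/-- **Cor. 9.8.1.3 for `Θ̃^{𝓘}_Joshi`** (p.116 l.63 – p.117 l.6) DERIVED exactly as printed: modulo (7), the locus is the
image of a subset of the compact `Ĩ_Joshi` under a continuous map, hence lies in a compact subset of `𝓘^ℚ_Joshi`. [folklore] -/
theorem cor9813J (h : C.LocusInShellsJ) : ∃ K : Set TJ, IsCompact K ∧ C.thetaLocusTensorJ ⊆ K :=
  ⟨C.toTensorJ '' C.shellsJ, C.isCompact_shellsJ.image C.toTensorJ_continuous, image_mono h⟩

/-- **Cor. 9.8.1.3 for `Θ̃^{𝓘}_Mochizuki`** DERIVED. [folklore] -/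
theorem cor9813M (h : C.LocusInShellsM) : ∃ K : Set TM, IsCompact K ∧ C.thetaLocusTensorM ⊆ K :=
  ⟨C.toTensorM '' C.shellsM, C.isCompact_shellsM.image C.toTensorM_continuous, image_mono h⟩

/-- The product loci themselves lie in the compact `Ĩ` («it is enough to prove the assertion for the latter sets», p.116
l.74). [folklore] -/
theorem cor9813_prod (hJ : C.LocusInShellsJ) (hM : C.LocusInShellsM) :
    (∃ K : Set C.ProdJ, IsCompact K ∧ C.thetaLocusProdJ ⊆ K) ∧ ∃ K : Set C.ProdM, IsCompact K ∧ C.thetaLocusProdM ⊆ K :=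
  ⟨⟨C.shellsJ, C.isCompact_shellsJ, hJ⟩, ⟨C.shellsM, C.isCompact_shellsM, hM⟩⟩

/-! ## 5. The exhibited element: the standard point contributes to the locus -/

/-- `Ψ^{Joshi}` is non-empty: collate the standard tuple `ξ_{z_Θ}` by any of the (existing) collation maps — the element
the fundamental estimate is read on. [folklore] -/
theorem psiJ_nonempty : C.psiJ.Nonempty := by
  classical
  refine ⟨fun i w => (C.coll_nonempty (C.pt C.zTheta i) w).some (C.xi _ w), C.zTheta, fun i w => ?_⟩
  exact ⟨_, (C.coll_nonempty _ w).some_mem, rfl⟩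

/-- Hence `Θ̃^{Ĩ}_Joshi` and `Θ̃^{𝓘}_Joshi` are non-empty. [folklore] -/
theorem thetaLocusJ_nonempty : C.thetaLocusProdJ.Nonempty ∧ C.thetaLocusTensorJ.Nonempty :=
  ⟨C.psiJ_nonempty.mono C.psiJ_subset_thetaLocusProdJ,
    (C.psiJ_nonempty.mono C.psiJ_subset_thetaLocusProdJ).image _⟩

/-! ## 6. Strength predicates on the collation maps (RQ7 audit of p428903 by abc-iut-E-t21: print has ISOMORPHISMS) -/

/-- **Collation maps are injective.** Print (Prop. 9.7.5.1 p.112 l.65–70; arXiv:2305.10398 Prop. 7.5.1 p.49 l.9–11 «under all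
the isomorphisms (of topological groups) of each factor») collates along ISOMORPHISMS `H¹_e(arith(L′)_y, ℤ(1)) ≃
H¹_e(arith(L′)_{y_0}, ℤ(1))`, whereas the field `coll` records only functions into the standard shell (audit flag on p428903:
WEAKER-THAN-PRINT on the bare signature — harmless for (4)–(7) and Cor. 9.8.1.3, which read images only, but load-bearing for
the sizes of §9.8.2 and any indeterminacy-shaped test). READING PREDICATE restoring the first half of the printed strength;
consumers take it BY NAME. [claim: Joshi2024ATS3, status: disputed] -/
@[claim "Joshi2024ATS3" "disputed"]
def CollInjective : Prop := ∀ (y : C.Y) (w : W), ∀ ι ∈ C.coll y w, Function.Injective ι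

/-- **Collation maps are onto the standard shell** — the second half: the target of the printed isomorphisms,
`H¹_e(arith(L′)_{y_0}, ℤ(1))` read through `log_BK`, IS the log-shell (Prop. 9.7.2.3 p.111 «Mochizuki's log-shell … can be
identified with the image, under the Bloch–Kato logarithm, of … H¹_e(G_{L_w}, ℤ_p(1))»). READING PREDICATE.
[claim: Joshi2024ATS3, status: disputed] -/
@[claim "Joshi2024ATS3" "disputed"]
def CollOntoShell : Prop := ∀ (y : C.Y) (w : W), ∀ ι ∈ C.coll y w, Set.range ι = C.shell w

/-- Under both predicates every collation map is a bijection of `H y w` onto the shell — print's isomorphism as a map of sets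
(the topological-group structure of `H¹_e` is not part of this signature). [folklore] -/
theorem coll_bijOn (h₁ : C.CollInjective) (h₂ : C.CollOntoShell) {y : C.Y} {w : W} {ι : C.H y w → V w}
    (hι : ι ∈ C.coll y w) : Set.BijOn ι Set.univ (C.shell w) := by
  refine ⟨fun x _ => ?_, (h₁ y w ι hι).injOn, fun s hs => ?_⟩
  · rw [← h₂ y w ι hι]; exact mem_range_self x
  · rw [image_univ, h₂ y w ι hι]; exact hs

/-- **Bridge to the equivalence-valued typings** (abc-iut-E-t21's `ATS3.ClassCollationDatum.iso : Set (H y w ≃ H std w)`,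
arXiv:2305.10398 Prop. 7.4.1's family, composed with the identification of the standard factor with the shell): if every
collation map factors as an equivalence onto the shell followed by the inclusion, both predicates hold. [folklore] -/
theorem collInjective_and_collOntoShell_of_equiv
    (h : ∀ (y : C.Y) (w : W), ∀ ι ∈ C.coll y w, ∃ e : C.H y w ≃ C.shell w, ι = Subtype.val ∘ e) :
    C.CollInjective ∧ C.CollOntoShell := by
  refine ⟨fun y w ι hι => ?_, fun y w ι hι => ?_⟩
  · obtain ⟨e, rfl⟩ := h y w ι hι
    exact Subtype.val_injective.comp e.injective
  · obtain ⟨e, rfl⟩ := h y w ι hι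
    ext v
    constructor
    · rintro ⟨x, rfl⟩
      exact (e x).2
    · intro hv
      exact ⟨e.symm ⟨v, hv⟩, by simp⟩

end TensorPacketLociDatum

end Summit.ABC.IUTFork.Joshi.ATS3

end
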